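import Literature.MathematicalPhysics.QuantumFieldTheory.BalabanImbrieJaffe1984to88.BIJ88Eq5128Locality
import Literature.MathematicalPhysics.QuantumFieldTheory.BalabanImbrieJaffe1984to88.BIJ88ExteriorForms5121

/-!
# `BalabanImbrieJaffe1984to88.BIJ88Eq5128ScalarSector` — T. Bałaban, J. Imbrie, A. Jaffe, *Effective action and cluster properties of the
abelian Higgs model*, Commun. Math. Phys. **114** (1988) 257–315 [BalabanImbrieJaffe1988], Sect. 5.12 *Conditional Integration*: the p. 300
identity *"for scalar fields"*, **(5.12.1)** (third form and `Z^{(k)}_{Λ^{(k)}_{10}}(u_{k+1})`), **(5.12.2)** (the interior integral and its `𝒩`),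
**(5.12.7)** (the scalar factor of `dμ^{(k)}_{Λ^{(k)}_{10}}`) and **(5.12.8)** p. 303 [PDF 47] — **THE SCALAR SECTOR OF THE CONDITIONING
INSTANTIATED BY NAME ON THE TORUS CARRIERS, AT MEASURE LEVEL: the factorization hypothesis `hfac` of `BIJ88Eq5128Frame.isDC_of_isDT`
DISCHARGED from the printed structure of the bracket, the weight data PROVED, `𝒩` EVALUATED by p10's/p02's coordinate theorems.**

statement-level skeleton of published theorems with citation tags; proofs where landed; nothing here is a claim about the Yang–Mills mass gap

THE PRINT (pp. 300–303 [PDF 44–47], verbatim in `BIJ88Conditioning512`, `BIJ88ExteriorForms5121`, `BIJ88Eq5128Display`; pp. 300–301 re-read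
this session as images, `HOME/lit-balaban-p02/pages/original-p044-x2.png`, `-p045-x2.png`).  p. 300: *"We exploit the simple structure in
Λ^{(k)}_{10} by doing the integrals there with conditioning on Λ^{(k)c}_{10}, Λ^{(k)c*c}_{10}. The formula we use is a generalization of the following
identity for scalar fields: ∫dφ|_{Λᶜ}F(φ|_{Λᶜ})∫dφ|_Λ e^{−⟨Λᶜφ,ΔΛφ⟩}e^{−½⟨φ,Δ_Λφ⟩}G(φ) = … = (∫dφ|_Λ e^{−½⟨φ,Δ_Λφ⟩}) ∫dφ|_{Λᶜ}F(φ|_{Λᶜ})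
e^{½⟨Λᶜφ,ΔΛΔ_Λ⁻¹ΛΔΛᶜφ⟩} × (1/𝒩)∫dφ|_Λ G(φ)e^{−½⟨φ,Δ_Λφ⟩}e^{−⟨Λᶜφ,ΔΛφ⟩}.  Here 𝒩 is equal to the last integral, without G(φ)."*  p. 301:
*"The third form, together with Z^{(k)}_{Λ^{(k)}_{10}}(u_{k+1}), is a calculation of ∫dφ^{(k)}|_{Λ^{(k)}_{10}} exp[−½⟨Λ^{(k)}_{10}φ^{(k)}, (Δ_{k,loc}(u_{k+1}) +
aL^{−2}P(u_{k+1}))(Λ^{(k)}_{10} + 2Λ^{(k)c}_{10})φ^{(k)}⟩]"*; (5.12.2) *"The "interior" integral is (1/𝒩)∫dφ^{(k)}|_{Λ^{(k)}_{10}} dA^{(k)}|_{Λ^{(k)c*c}_{10}} …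
exp[−½⟨Λ^{(k)}_{10}φ^{(k)}, (Δ_{k,loc}(u_{k+1}) + aL^{−2}P(u_{k+1}))(Λ^{(k)}_{10} + 2Λ^{(k)c}_{10})φ^{(k)}⟩ − … − V^{(k)}(…)]. Here 𝒩 is defined by the last
integral, but without χ′_{Λ^{(k)}_7}, F^{m̄}_{k,loc}, or V^{(k)}"*; p. 302: *"Here dμ^{(k)}_{Λ^{(k)}_{10}} is an uncentered, normalized Gaussian measure …
(1/𝒩) dA^{(k)″} dφ^{(k)″} … exp[…] (5.12.7). This measure has covariances C^{(k)}_{Λ^{(k)c*c}_{10}}, C^{(k)}_{Λ^{(k)}_{10}}(u_{k+1}), and nonzero means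
reflecting the terms linear in Λ^{(k)}_{10}φ^{(k)″} or Λ^{(k)c*c}_{10}A^{(k)″}."*

WHAT THIS FILE DOES (seat p34 gen 11; the owner's recorded flip condition for row C2.Eq5.12.8, r16 2026-08-22T02:48:36Z: *"`hfac`
instantiated … BY NAME from the (5.12.1)–(5.12.7) theorems of record … leaving only printed data + integrability as hypotheses"*).  Gen 10's
`BIJ88Eq5128Frame.isDC_of_isDT` proves (5.9.6) ⇒ (5.12.8) at measure level for ANY pointwise factorization `bracket = Xf(freeze q)·W(q)·B(q)`
(`hfac`) with a measurable positive fibre-integrable weight (`hWm`/`hW0`/`hWi`).  Here the SCALAR SECTOR of Sect. 5.12 is made explicit: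
 §0 `realCoords` — `φ^{(k)} ∈ ℂ^{sites}` in real coordinates `S = sites × {re, im}` (`Complex.measurableEquivPi`), so that p10's model
    `B2Eq228Conditioning`/`BIJ88Conditioning512` (index type `S`, region predicate `p` = `inIx D` = `Λ^{(k)}_{10}`, `x = φ|_Λ`, `y = φ|_{Λᶜ}`,
    `glue`) applies BY NAME; the interior chart `chartIn : ℂ^{Λ₁₀} ≃ᵐ ℝ^{In p}` is VOLUME PRESERVING (`measurePreserving_chartIn`, boxes);
 §1 `sW` = THE SCALAR WEIGHT = p10's `wIn · cpl` (`e^{−½⟨φ,M_Λφ⟩}e^{−⟨Λᶜφ,MΛφ⟩}`, = the printed integrand of (5.12.2), `sW_eq_printed`) at the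
    precision `M_t(v)` read at the block field, `sX` = the exterior Gaussian `exp(−½⟨Λᶜφ, MΛᶜφ⟩)`; **`hfac_scalar`**: if the bracket read on
    configurations is `X₀·exp(−½⟨φ^{(k)}, M_t(v)φ^{(k)}⟩)·B₀` with `X₀` interior-independent and `M_t` symmetric, then `hfac` HOLDS with
    `Xf = X₀·sX`, `W = sW`, `B = B₀` (`B2Eq228Conditioning.quadForm_glue`); the weight data: `measurable_sW` (`hWm`), `sW_pos` (`hW0`),
    `integrable_sW_fibre` (`hWi`: `integrable_tilt`, `M_Λ` positive definite, transported along the chart);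
 §2 **`isDC_of_isDT_scalar`** — (5.9.6) `IsDT (Π_b m_b)` + the structural hypothesis ⇒ (5.12.8) `IsDC` with exterior bracket `X₀·sX·𝒩`, interior
    law `condW` of `sW` = the printed `(1/𝒩) dφ|_{Λ₁₀} (interior laws) exp[…]` of (5.12.2)/(5.12.7) (scalar factor) and interior bracket `B₀`;
 §3 **`normW_sW`**: the frame's `𝒩` IS p10's `calN` (*"𝒩 is equal to the last integral, without G"*); `calN_eq_Zscalar_mul_exp_thirdForm`:
    `= Z_{Λ₁₀}(M)·e^{thirdForm}` (p02's `Zscalar`, `thirdForm`; p10's `calN_eq`); **`eq5128_scalar`**: (5.12.8) with the exterior `φ^{(k)}`-Gaussian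
    *"replaced by"* the third form of (5.12.1) and `Z^{(k)}_{Λ₁₀}(u_{k+1})`; `thirdForm_blockLocal` (the printed `Δ_{k,loc}` alone in the third form
    when `P` has no `Λ₁₀ × Λ₁₀ᶜ` block);
 §4 **`integral_condW_sW`** — the interior integral is `𝒩⁻¹∫(wIn·cpl)·G`; **`integral_condW_sW_scalar_obs`** — p. 302 BY NAME for observables
    of the interior scalar field: under `dμ_{Λ₁₀}` the coordinates `φ^{(k)″}|_{Λ₁₀}` follow `gaussProb (M_Λ)` translated by `−M_Λ⁻¹(ΛMΛᶜφ)`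
    (p10's `normalized_eq_gaussProb`; covariance `C_{Λ₁₀}(u_{k+1}) = M_Λ⁻¹`, p02's `BIJ88Measure5127.muφ`/`meanφ` in these coordinates);
 §5 instances: `eq5128_scalar_axial` (`ν = 𝒟u δ_{Ax}`), **`eq5128_scalar_qU`** (the locality `hv` BY NAME for r18's block average `qU` under the
    nesting condition of p. 300, `BIJ88Eq5128Locality.vCut_freeze_eq_qU`) — hypotheses left: printed data (`M_t` symmetric with positive
    definite `Λ₁₀`-block and measurable entries, `X₀`, `B₀`, the index sets) and integrability (`hJi`).
HONEST SCOPE.  (i) THE GAUGE SECTOR of the weight — `exp[−½⟨Λ^{c*c}_{10}A″, ∂*σ_{k,loc}∂(Λ^{c*c}_{10} + 2Λ^{c*}_{10})A⟩]`, (5.12.3)–(5.12.6), the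
factors `Z_{Λ^{c*c}_{10}}`, the fourth/fifth forms, `𝒬₇`, `𝒬₈` — is NOT instantiated here: at measure level the interior bond variables are
`u_b ∈ U(1)` under Haar/Dirac laws, while the print's `dA^{(k)″}` (p. 301: *"the replacement of du^{(k)} with dA^{(k)} for the free variables"*) is
Lebesgue measure in a chart; those factors stay inside `X₀`/`B₀` (reading recorded in HOME/GAPS.md); (ii) the localized translation (5.12.6) and
the random-walk forms of p. 302 are not performed (the weight is the pre-translation integrand of (5.12.2); `BIJ88Eq5128CondExpect.condMeasure_const_mul`
is the cancellation sentence); (iii) which printed factors make up `X₀`, `B₀` is the reading table of `BIJ88Eq5128Display` and is not repeated;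
no bound anywhere.  0 `sorry`, no `Prop`-valued fact, standard axioms.

CITATION HEADER (lean-in-tree rule).  Part of the lit-balaban TYPED SKELETON (HOME `run/shared/lean/pub/lit-balaban/`), PHASE-2 proof seat p34
gen 11 (unit `lit-balaban-p34-g11`; TAKING line HOME/STATUS.md 2026-08-22T03:46:19Z; free-target protocol G.5-34(d), own lineage = the C1/C2
renormalization-transformation line at measure level).  Row served: **`C2.Eq5.12.8`** of `HOME/lit-balaban-r16/ROWS-C2-part2.md` (owner r16;
typed since v2.66); support `C2.Eq5.12.1-5.12.7`, `C2.Txt@300`.  Built BY NAME on p10's `BIJ88Conditioning512` (`wIn`, `cpl`, `calN`, `calN_eq`,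
`normalized_eq_gaussProb`), p02's `BIJ88ExteriorForms5121` (`Zscalar`, `thirdForm`, `integrand_eq_wIn_cpl`, `blkMix_add_of_blockLocal`), r02/r14's
`B2Eq228Conditioning` (`glue`, `quadForm_glue`, `integral_tilt`, `gaussProb`), this seat's `BIJ88Eq5128Frame`/`Locality`/`Display`/`Split`; nothing
restated.  PDF held: `paper:balaban1988-cmp114-bij-abelian-higgs-effective-action` (journal page = PDF page + 256).  Imports Literature + Mathlib only.
-/

namespace Literature.MathematicalPhysics.QuantumFieldTheory.BalabanImbrieJaffe1984to88.BIJ88Eq5128ScalarSector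

open Literature.MathematicalPhysics.QuantumFieldTheory.Balaban1983to89
open BIJ88Sect3Statements (U1)
open BIJ85Sect1Model (HiggsField)
open BIJ88InductiveForm41 (Prev)
open BIJ88Eq596Display (uCut vCut vCut_apply IsDT)
open BIJ88Eq5128CondExpect (condNorm condMeasure condNorm_pos integral_condMeasure integral_condMeasure_mul)
open BIJ88Eq5128Split (Cfg UCfg PCfg cfgMeasure prevPi Interior)
open BIJ88Eq5128Display (IsDC termMeasure termIntegrand readEntry axialLaw)
open BIJ88Eq5128Display.Weight (normW condW normW_glue integral_condW_glue)
open BIJ88Eq5128Frame (isDC_of_isDT isDT_axial_iff)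
open B2Eq228Conditioning (In Out resIn resOut glue blkIn blkMix blkMix' blkOut quadForm_glue glue_resIn_resOut integral_tilt
  integrable_tilt)
open BIJ88Conditioning512 (wIn cpl calN srcJ lastInt calN_eq calN_pos wIn_mul_cpl mix_dot_eq)
open BIJ88ExteriorForms5121 (Zscalar thirdForm)
open scoped BigOperators ENNReal Matrix
open _root_.MeasureTheory _root_.MeasureTheory.Measure Function Set

noncomputable section

attribute [local instance 1001] Subtype.fintype

variable {P : Params} {k : ℕ}

/-! ## §0 Real coordinates of the Higgs field `φ^{(k)}` and of its interior part `φ^{(k)}|_{Λ^{(k)}_{10}}` -/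

/-- Index of a real coordinate of `φ^{(k)} ∈ ℂ^{sites}`: a site and a real/imaginary-part label. [cite: BalabanImbrieJaffe1988, (5.12.2) p.301] -/
abbrev RIdx (P : Params) (k : ℕ) : Type := Balaban1983to89.Site P k × Fin 2

/-- `φ^{(k)}` in real coordinates (`![re, im]` per site, Mathlib's `Complex.measurableEquivPi`). [cite: BalabanImbrieJaffe1988, (5.12.2) p.301] -/
def realCoords (φ : HiggsField P k) : RIdx P k → ℝ := fun s => Complex.measurableEquivPi (φ s.1) s.2

/-- kernel: the value of a real coordinate. [cite: BalabanImbrieJaffe1988, (5.12.2) p.301] -/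
theorem realCoords_apply (φ : HiggsField P k) (s : RIdx P k) : realCoords φ s = ![(φ s.1).re, (φ s.1).im] s.2 := rfl

/-- kernel: passing to real coordinates is measurable. [cite: BalabanImbrieJaffe1988, (5.12.2) p.301] -/
theorem measurable_realCoords : Measurable (realCoords : HiggsField P k → RIdx P k → ℝ) :=
  measurable_pi_lambda _ fun s => (measurable_pi_apply s.2).comp (Complex.measurableEquivPi.measurable.comp (measurable_pi_apply s.1))

section Chart

variable (D : Interior P k)

/-- The integrated region `Λ = Λ^{(k)}_{10}` of the p. 300 identity as a predicate on real coordinates (the `p` of p10's model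
`B2Eq228Conditioning`/`BIJ88Conditioning512`: `In p` = real coordinates of `φ|_{Λ₁₀}`, `Out p` = of `φ|_{Λ₁₀ᶜ}`). [cite: BalabanImbrieJaffe1988, (5.12.2) p.301] -/
abbrev inIx (D : Interior P k) (s : RIdx P k) : Prop := s.1 ∈ D.Ix

/-- the interior real coordinates `φ|_Λ` (p10's `x`) of a configuration `q = (u, {u^{(j)}}, φ^{(k)})`. [cite: BalabanImbrieJaffe1988, (5.12.2) p.301] -/
def xOf (q : Cfg P k) : In (inIx D) → ℝ := resIn (inIx D) (realCoords q.2.2)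

/-- the exterior real coordinates `φ|_{Λᶜ}` (p10's `y`) of a configuration. [cite: BalabanImbrieJaffe1988, (5.12.2) p.301] -/
def yOf (q : Cfg P k) : Out (inIx D) → ℝ := resOut (inIx D) (realCoords q.2.2)

/-- **`φ^{(k)} = (φ|_Λ on Λ, φ|_{Λᶜ} on Λᶜ)`** in real coordinates (p10's `glue`). [cite: BalabanImbrieJaffe1988, (5.12.2) p.301] -/
theorem realCoords_eq_glue (q : Cfg P k) : realCoords q.2.2 = glue (inIx D) (xOf D q) (yOf D q) :=
  (glue_resIn_resOut (inIx D) (realCoords q.2.2)).symm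

/-- **The real chart of the interior scalar variables**: `φ^{(k)″}|_{Λ₁₀} ∈ ℂ^{Λ₁₀} ≃ ℝ^{In}`. [cite: BalabanImbrieJaffe1988, (5.12.7) p.302] -/
def chartIn : D.IX ≃ᵐ (In (inIx D) → ℝ) where
  toFun c s := Complex.measurableEquivPi (c ⟨s.1.1, s.2⟩) s.1.2
  invFun x i := Complex.measurableEquivPi.symm fun j => x ⟨(i.1, j), i.2⟩
  left_inv c := by
    funext i
    exact Complex.measurableEquivPi.symm_apply_apply (c i)
  right_inv x := by
    funext s
    change Complex.measurableEquivPi (Complex.measurableEquivPi.symm fun j => x ⟨(s.1.1, j), s.2⟩) s.1.2 = x s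
    rw [MeasurableEquiv.apply_symm_apply]
  measurable_toFun := measurable_pi_lambda _ fun s =>
    (measurable_pi_apply s.1.2).comp (Complex.measurableEquivPi.measurable.comp (measurable_pi_apply _))
  measurable_invFun := measurable_pi_lambda _ fun i =>
    Complex.measurableEquivPi.symm.measurable.comp (measurable_pi_lambda _ fun j => measurable_pi_apply _)

/-- kernel: the value of the interior chart. [cite: BalabanImbrieJaffe1988, (5.12.7) p.302] -/
@[simp] theorem chartIn_apply (c : D.IX) (s : In (inIx D)) : chartIn D c s = Complex.measurableEquivPi (c ⟨s.1.1, s.2⟩) s.1.2 := rfl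

/-- the exterior scalar variables in real coordinates. [cite: BalabanImbrieJaffe1988, (5.12.8) p.303] -/
def chartOut (e : D.EX) : Out (inIx D) → ℝ := fun s => Complex.measurableEquivPi (e ⟨s.1.1, s.2⟩) s.1.2

/-- kernel: the interior real coordinates of a configuration are the chart of its interior scalar variables. [cite: BalabanImbrieJaffe1988, (5.12.7) p.302] -/
theorem xOf_eq (q : Cfg P k) : xOf D q = chartIn D (D.split q).2.2.2 := rfl

/-- kernel: the exterior real coordinates of a configuration depend on its exterior variables only. [cite: BalabanImbrieJaffe1988, (5.12.8) p.303] -/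
theorem yOf_eq (q : Cfg P k) : yOf D q = chartOut D (D.split q).1.2.2 := rfl

/-- kernel: interior real coordinates of a glued configuration. [cite: BalabanImbrieJaffe1988, (5.12.7) p.302] -/
theorem xOf_glue (e : D.Ext) (i : D.Int) : xOf D (D.glue e i) = chartIn D i.2.2 := by
  rw [xOf_eq, Interior.split_glue]

/-- kernel: exterior real coordinates of a glued configuration. [cite: BalabanImbrieJaffe1988, (5.12.8) p.303] -/
theorem yOf_glue (e : D.Ext) (i : D.Int) : yOf D (D.glue e i) = chartOut D e.2.2 := by
  rw [yOf_eq, Interior.split_glue]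

/-- kernel: freezing the interior variables does not change the exterior real coordinates. [cite: BalabanImbrieJaffe1988, (5.12.8) p.303] -/
theorem yOf_freeze (q : Cfg P k) : yOf D (D.freeze q) = yOf D q := by
  rw [yOf_eq, yOf_eq, Interior.split_freeze]

/-- the index equivalence `Λ₁₀ × {re, im} ≃ In` behind the chart. [folklore] -/
def idxEquiv : {x // x ∈ D.Ix} × Fin 2 ≃ In (inIx D) where
  toFun p := ⟨(p.1.1, p.2), p.1.2⟩
  invFun s := (⟨s.1.1, s.2⟩, s.1.2)
  left_inv _ := rfl
  right_inv _ := rfl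

/-- **The interior chart preserves Lebesgue measure**: `dφ^{(k)}|_{Λ₁₀}` (product Lebesgue measure on `ℂ^{Λ₁₀}`) is carried to `dx` on `ℝ^{In}`
(`Complex.volume_preserving_equiv_pi` site by site; boxes to boxes). [cite: BalabanImbrieJaffe1988, (5.12.7) p.302] -/
theorem measurePreserving_chartIn : MeasurePreserving (chartIn D) (volume : Measure D.IX) (volume : Measure (In (inIx D) → ℝ)) := by
  refine ⟨(chartIn D).measurable, ?_⟩
  rw [show (volume : Measure (In (inIx D) → ℝ)) = Measure.pi fun _ => volume from volume_pi]
  symm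
  refine Measure.pi_eq fun s hs => ?_
  rw [Measure.map_apply (chartIn D).measurable (MeasurableSet.univ_pi hs)]
  have hpre : (chartIn D) ⁻¹' Set.univ.pi s =
      Set.univ.pi fun i : {x // x ∈ D.Ix} => Complex.measurableEquivPi ⁻¹' Set.univ.pi fun j : Fin 2 => s ⟨(i.1, j), i.2⟩ := by
    ext c
    simp only [Set.mem_preimage, Set.mem_univ_pi, chartIn_apply]
    exact ⟨fun h i j => h ⟨(i.1, j), i.2⟩, fun h t => h ⟨t.1.1, t.2⟩ t.1.2⟩
  rw [hpre, volume_pi, Measure.pi_pi]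
  simp_rw [Complex.volume_preserving_equiv_pi.measure_preimage_equiv, volume_pi, Measure.pi_pi]
  rw [← Fintype.prod_equiv (idxEquiv D) (fun p => volume (s (idxEquiv D p))) (fun t => volume (s t)) fun _ => rfl,
    Fintype.prod_prod_type]
  rfl

/-- **Integration over the interior scalar variables in real coordinates**: `∫_{ℂ^{Λ₁₀}} F(chart c) dc = ∫_{ℝ^{In}} F(x) dx`.
[cite: BalabanImbrieJaffe1988, (5.12.7) p.302] -/
theorem integral_chartIn {E : Type*} [NormedAddCommGroup E] [NormedSpace ℝ E] (F : (In (inIx D) → ℝ) → E) :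
    ∫ c : D.IX, F (chartIn D c) = ∫ x : In (inIx D) → ℝ, F x :=
  (measurePreserving_chartIn D).integral_comp' F

end Chart

/-! ## §1 The scalar weight of Sect. 5.12 on the torus carriers, BY NAME (p10's `wIn · cpl`) -/

section Scalar

variable {ι : Type*} (Λ : ι → Finset (PBond P (k+1))) (Qu : GaugeField P k U1 → GaugeField P (k+1) U1)
variable (D : ι → Interior P k) (M : ι → GaugeField P (k+1) U1 → Matrix (RIdx P k) (RIdx P k) ℝ)

/-- The precision of the `φ^{(k)}`-Gaussian of term `t` READ ON A CONFIGURATION: `M_t(v_{Λ_t}(u, v′))` — in print the matrix, in real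
coordinates, of `Δ_{k,loc}(u_{k+1}) + aL^{−2}P(u_{k+1})`, a function of the block field through `u_{k+1} = u_{k+1}(v)`.
[cite: BalabanImbrieJaffe1988, (5.12.2) p.301] -/
def Mq (t : ι) (q : Cfg P k) (v' : GaugeField P (k+1) U1) : Matrix (RIdx P k) (RIdx P k) ℝ := M t (vCut Qu (Λ t) q.1 v')

/-- **THE SCALAR WEIGHT OF TERM `t`** — the integrand `e^{−½⟨φ, M_Λφ⟩} e^{−⟨Λᶜφ, MΛφ⟩}` of *"the last integral"* of p. 300 / of `𝒩` in (5.12.2),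
i.e. p10's `BIJ88Conditioning512.wIn · cpl` BY NAME, in the real coordinates `x = φ^{(k)}|_{Λ₁₀}`, `y = φ^{(k)}|_{Λ₁₀ᶜ}` of the configuration, with
the precision `M_t` read at the block field. [cite: BalabanImbrieJaffe1988, (5.12.2) p.301] -/
def sW (t : ι) (q : Cfg P k) (v' : GaugeField P (k+1) U1) : ℝ :=
  wIn (inIx (D t)) (Mq Λ Qu M t q v') (xOf (D t) q) * cpl (inIx (D t)) (Mq Λ Qu M t q v') (xOf (D t) q) (yOf (D t) q)

/-- **THE EXTERIOR GAUSSIAN FACTOR** `exp(−½⟨Λᶜφ, MΛᶜφ⟩)` — the `Λ₁₀ᶜ × Λ₁₀ᶜ` part of the quadratic form, which *stays in the exterior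
integral* (p. 301: the exterior integral *"whose Gaussian piece has been replaced by"* (5.12.1)). [cite: BalabanImbrieJaffe1988, (5.12.1) p.301] -/
def sX (t : ι) (q : Cfg P k) (v' : GaugeField P (k+1) U1) : ℝ :=
  Real.exp (-(1 / 2 : ℝ) * (yOf (D t) q ⬝ᵥ (blkOut (inIx (D t)) (Mq Λ Qu M t q v') *ᵥ yOf (D t) q)))

/-- **THE SPLITTING OF THE GAUSSIAN** (the algebra behind the p. 300 identity and (5.12.1)–(5.12.2), scalar sector): for symmetric `M`,
`exp(−½⟨φ, Mφ⟩) = exp(−½⟨Λᶜφ, MΛᶜφ⟩) · [e^{−½⟨Λφ, M_ΛΛφ⟩} e^{−⟨Λᶜφ, MΛφ⟩}]` with `φ = (x on Λ, y on Λᶜ)` (`B2Eq228Conditioning.quadForm_glue`).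
[cite: BalabanImbrieJaffe1988, (5.12.2) p.301] -/
theorem exp_quadForm_glue {S : Type} [Fintype S] (p : S → Prop) [DecidablePred p] (A : Matrix S S ℝ) (hA : A.IsSymm)
    (x : In p → ℝ) (y : Out p → ℝ) :
    Real.exp (-(1 / 2 : ℝ) * (glue p x y ⬝ᵥ (A *ᵥ glue p x y))) =
      Real.exp (-(1 / 2 : ℝ) * (y ⬝ᵥ (blkOut p A *ᵥ y))) * (wIn p A x * cpl p A x y) := by
  rw [quadForm_glue, wIn, cpl, ← Real.exp_add, ← Real.exp_add]
  congr 1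
  have hm : x ⬝ᵥ (blkMix p A *ᵥ y) = y ⬝ᵥ (blkMix' p A *ᵥ x) := by
    rw [mix_dot_eq p A hA x y]; unfold srcJ; exact dotProduct_comm _ _
  rw [hm]; ring

variable {Λ Qu D M}

/-- kernel: the precision read on a configuration depends on it only through the block field. [cite: BalabanImbrieJaffe1988, (5.12.2) p.301] -/
theorem Mq_congr {t : ι} {q q' : Cfg P k} {v' : GaugeField P (k+1) U1} (h : vCut Qu (Λ t) q.1 v' = vCut Qu (Λ t) q'.1 v') :
    Mq Λ Qu M t q v' = Mq Λ Qu M t q' v' := by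
  simp only [Mq, h]

/-- kernel: the exterior Gaussian factor does not see the interior variables (given the locality of the block field).
[cite: BalabanImbrieJaffe1988, (5.12.1) p.301] -/
theorem sX_freeze {t : ι} {q : Cfg P k} {v' : GaugeField P (k+1) U1} (hvq : vCut Qu (Λ t) ((D t).freeze q).1 v' = vCut Qu (Λ t) q.1 v') :
    sX Λ Qu D M t ((D t).freeze q) v' = sX Λ Qu D M t q v' := by
  simp only [sX, Mq, hvq, yOf_freeze]

/-- **THE SCALAR WEIGHT IS THE PRINTED INTEGRAND OF (5.12.2)**: `exp[−½⟨Λ₁₀φ^{(k)}, M(Λ₁₀ + 2Λ₁₀ᶜ)φ^{(k)}⟩]` (p02's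
`BIJ88ExteriorForms5121.integrand_eq_wIn_cpl`, `chiIn`/`chiOut` = `Λ₁₀φ`, `Λ₁₀ᶜφ`). [cite: BalabanImbrieJaffe1988, (5.12.2) p.301] -/
theorem sW_eq_printed (hMs : ∀ t v, (M t v).IsSymm) (t : ι) (q : Cfg P k) (v' : GaugeField P (k+1) U1) :
    sW Λ Qu D M t q v' = Real.exp (-(1 / 2 : ℝ) * (BIJ88ExteriorForms5121.chiIn (inIx (D t)) (xOf (D t) q) ⬝ᵥ
      (Mq Λ Qu M t q v' *ᵥ (BIJ88ExteriorForms5121.chiIn (inIx (D t)) (xOf (D t) q) +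
        (2 : ℝ) • BIJ88ExteriorForms5121.chiOut (inIx (D t)) (yOf (D t) q))))) :=
  (BIJ88ExteriorForms5121.integrand_eq_wIn_cpl (inIx (D t)) (Mq Λ Qu M t q v') (hMs t _) (xOf (D t) q) (yOf (D t) q)).symm

/-- **THE FACTORIZATION `hfac` OF `BIJ88Eq5128Frame.isDC_of_isDT`, DISCHARGED FOR THE SCALAR SECTOR.**  If the bracket of the (expanded) translated
display, read on configurations, is `X₀ · exp(−½⟨φ^{(k)}, M_t(v)φ^{(k)}⟩) · B₀` with `X₀` not depending on the interior variables and `M_t(v)` symmetric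
(*"a Gaussian integral in φ^{(k)}"*, p. 300, times the factors of lines 2–8 of (5.9.6)), then it factors as (exterior factor at the frozen
configuration) × (the scalar weight `wIn · cpl`) × `B₀` — the content of (5.12.1)–(5.12.2) for the scalar sector. [cite: BalabanImbrieJaffe1988, (5.12.2) p.301] -/
theorem hfac_scalar {terms : Finset ι} (hMs : ∀ t v, (M t v).IsSymm)
    {J : ι → Prev P k → GaugeField P k U1 → GaugeField P (k+1) U1 → HiggsField P k → HiggsField P (k+1) → ℂ}
    {X₀ B₀ : ι → Cfg P k → GaugeField P (k+1) U1 → HiggsField P (k+1) → ℂ}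
    (hv : ∀ t ∈ terms, ∀ (q : Cfg P k) (v' : GaugeField P (k+1) U1), vCut Qu (Λ t) ((D t).freeze q).1 v' = vCut Qu (Λ t) q.1 v')
    (hX₀ : ∀ t ∈ terms, ∀ q v' ψ, X₀ t ((D t).freeze q) v' ψ = X₀ t q v' ψ)
    (hJ : ∀ t ∈ terms, ∀ q v' ψ, readEntry Λ Qu J t q v' ψ =
      X₀ t q v' ψ * (Real.exp (-(1 / 2 : ℝ) * (realCoords q.2.2 ⬝ᵥ (M t (vCut Qu (Λ t) q.1 v') *ᵥ realCoords q.2.2))) : ℂ) * B₀ t q v' ψ) :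
    ∀ t ∈ terms, ∀ (q : Cfg P k) (v' : GaugeField P (k+1) U1) (ψ : HiggsField P (k+1)),
      J t q.2.1 (uCut Qu (Λ t) q.1) (vCut Qu (Λ t) q.1 v') q.2.2 ψ =
        (X₀ t ((D t).freeze q) v' ψ * (sX Λ Qu D M t ((D t).freeze q) v' : ℂ)) * (sW Λ Qu D M t q v' : ℂ) * B₀ t q v' ψ := by
  intro t ht q v' ψ
  have e1 := hJ t ht q v' ψ
  rw [readEntry] at e1
  rw [e1, hX₀ t ht, sX_freeze (hv t ht q v'), realCoords_eq_glue (D t) q, exp_quadForm_glue _ _ (hMs t _)]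
  simp only [sW, sX, Mq]
  push_cast
  ring

/-! ### Weight data: measurability, positivity, fibre integrability -/

/-- kernel: the block field of the display is jointly measurable in `(u, v′)` (read through measurable maps). [cite: BalabanImbrieJaffe1988, (5.12.8) p.303] -/
theorem measurable_vCut_comp (hQu : Measurable Qu) (Λ₀ : Finset (PBond P (k+1))) {α : Type*} [MeasurableSpace α]
    {fu : α → GaugeField P k U1} {fv : α → GaugeField P (k+1) U1} (hfu : Measurable fu) (hfv : Measurable fv) :
    Measurable fun a => vCut Qu Λ₀ (fu a) (fv a) := by
  refine measurable_pi_iff.mpr fun c => ?_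
  by_cases hc : c ∈ Λ₀
  · simp only [vCut_apply, if_pos hc]; exact (measurable_pi_apply c).comp hfv
  · simp only [vCut_apply, if_neg hc]; exact (measurable_pi_apply c).comp (hQu.comp hfu)

/-- kernel: measurability of the interior real coordinates. [cite: BalabanImbrieJaffe1988, (5.12.2) p.301] -/
theorem measurable_xOf (D₀ : Interior P k) : Measurable (xOf D₀ : Cfg P k → In (inIx D₀) → ℝ) :=
  measurable_pi_lambda _ fun i => (measurable_pi_apply i.1).comp (measurable_realCoords.comp measurable_snd.snd)

/-- kernel: measurability of the exterior real coordinates. [cite: BalabanImbrieJaffe1988, (5.12.2) p.301] -/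
theorem measurable_yOf (D₀ : Interior P k) : Measurable (yOf D₀ : Cfg P k → Out (inIx D₀) → ℝ) :=
  measurable_pi_lambda _ fun j => (measurable_pi_apply j.1).comp (measurable_realCoords.comp measurable_snd.snd)

/-- kernel: p10's weight `wIn · cpl` is jointly measurable in (matrix entries, `x`, `y`). [cite: BalabanImbrieJaffe1988, (5.12.2) p.301] -/
theorem measurable_wIn_cpl {α : Type*} [MeasurableSpace α] {S : Type} [Fintype S] (p : S → Prop) [DecidablePred p]
    {A : α → Matrix S S ℝ} (hA : ∀ i j, Measurable fun a => A a i j) {x : α → In p → ℝ} (hx : Measurable x)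
    {y : α → Out p → ℝ} (hy : Measurable y) :
    Measurable fun a => wIn p (A a) (x a) * cpl p (A a) (x a) (y a) := by
  have hxi : ∀ i, Measurable fun a => x a i := fun i => (measurable_pi_apply i).comp hx
  have hyj : ∀ j, Measurable fun a => y a j := fun j => (measurable_pi_apply j).comp hy
  have h1 : Measurable fun a => x a ⬝ᵥ (blkIn p (A a) *ᵥ x a) := by
    simp only [dotProduct, Matrix.mulVec, blkIn, Matrix.submatrix_apply]
    exact Finset.measurable_sum _ fun i _ => (hxi i).mul (Finset.measurable_sum _ fun j _ => (hA _ _).mul (hxi j))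
  have h2 : Measurable fun a => y a ⬝ᵥ (blkMix' p (A a) *ᵥ x a) := by
    simp only [dotProduct, Matrix.mulVec, blkMix', Matrix.submatrix_apply]
    exact Finset.measurable_sum _ fun i _ => (hyj i).mul (Finset.measurable_sum _ fun j _ => (hA _ _).mul (hxi j))
  unfold wIn cpl
  exact (Real.measurable_exp.comp (measurable_const.mul h1)).mul (Real.measurable_exp.comp h2.neg)

/-- **The scalar weight is jointly measurable** in `(q, v′, ψ)` (the datum `hWm` of the frame), given measurable matrix entries `v ↦ M_t(v)_{ij}`
and a measurable block average. [cite: BalabanImbrieJaffe1988, (5.12.7) p.302] -/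
theorem measurable_sW (hQu : Measurable Qu) (hMm : ∀ t i j, Measurable fun v => M t v i j) (t : ι) {α : Type*} [MeasurableSpace α]
    {f : α → Cfg P k} {g : α → GaugeField P (k+1) U1} (hf : Measurable f) (hg : Measurable g) :
    Measurable fun a => sW Λ Qu D M t (f a) (g a) := by
  unfold sW Mq
  exact measurable_wIn_cpl (inIx (D t)) (fun i j => (hMm t i j).comp (measurable_vCut_comp hQu (Λ t) (measurable_fst.comp hf) hg))
    ((measurable_xOf (D t)).comp hf) ((measurable_yOf (D t)).comp hf)

/-- **The scalar weight is strictly positive** (the datum `hW0`). [cite: BalabanImbrieJaffe1988, (5.12.7) p.302] -/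
theorem sW_pos (t : ι) (q : Cfg P k) (v' : GaugeField P (k+1) U1) : 0 < sW Λ Qu D M t q v' := by
  unfold sW wIn cpl
  exact mul_pos (Real.exp_pos _) (Real.exp_pos _)

/-- kernel: p10's weight is Lebesgue-integrable in `x` for symmetric `M` with positive definite `M_Λ` (`wIn_mul_cpl` + `integrable_tilt`).
[cite: BalabanImbrieJaffe1988, (5.12.2) p.301] -/
theorem integrable_wIn_cpl {S : Type} [Fintype S] [DecidableEq S] (p : S → Prop) [DecidablePred p] {A : Matrix S S ℝ} (hA : A.IsSymm)
    (hpd : (blkIn p A).PosDef) (y : Out p → ℝ) : Integrable (fun x => wIn p A x * cpl p A x y) := by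
  simp_rw [wIn_mul_cpl p A hA]
  exact integrable_tilt hpd _

/-- **The scalar weight on an interior fibre**: at the glued configuration `glue e i` it is p10's integrand at `x = chart(i)`, with the precision
and `y` determined by the exterior variables `e` (locality of the block field). [cite: BalabanImbrieJaffe1988, (5.12.2) p.301] -/
theorem sW_glue (t : ι) (v' : GaugeField P (k+1) U1)
    (hvq : ∀ q : Cfg P k, vCut Qu (Λ t) ((D t).freeze q).1 v' = vCut Qu (Λ t) q.1 v') (e : (D t).Ext) (i : (D t).Int) :
    sW Λ Qu D M t ((D t).glue e i) v' =
      wIn (inIx (D t)) (M t (vCut Qu (Λ t) ((D t).glue e (D t).base).1 v')) (chartIn (D t) i.2.2) *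
        cpl (inIx (D t)) (M t (vCut Qu (Λ t) ((D t).glue e (D t).base).1 v')) (chartIn (D t) i.2.2) (chartOut (D t) e.2.2) := by
  have hv' : vCut Qu (Λ t) ((D t).glue e i).1 v' = vCut Qu (Λ t) ((D t).glue e (D t).base).1 v' := by
    rw [← hvq ((D t).glue e i), Interior.freeze_glue]
  simp only [sW, Mq, hv', xOf_glue, yOf_glue]

variable {m : PBond P k → Measure U1} [∀ b, IsProbabilityMeasure (m b)]

/-- kernel: an integrand depending on the interior SCALAR variables only integrates over the interior measure as over `dφ^{(k)}|_{Λ₁₀}` (the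
interior gauge laws have mass one). [cite: BalabanImbrieJaffe1988, (5.12.7) p.302] -/
theorem integral_μInt_scalar (D₀ : Interior P k) {E : Type*} [NormedAddCommGroup E] [NormedSpace ℝ E] (F : D₀.IX → E) :
    ∫ i, F i.2.2 ∂D₀.μInt m = ∫ c, F c ∂(volume : Measure D₀.IX) := by
  unfold Interior.μInt
  rw [integral_fun_snd (f := fun w : D₀.IP × D₀.IX => F w.2), integral_fun_snd (f := F), probReal_univ, probReal_univ,
    one_smul, one_smul]

/-- **The scalar weight is integrable over each interior fibre** (the datum `hWi`; a convergent Gaussian integral, `M_Λ` positive definite).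
[cite: BalabanImbrieJaffe1988, (5.12.7) p.302] -/
theorem integrable_sW_fibre (hMs : ∀ t v, (M t v).IsSymm) (hMpd : ∀ t v, (blkIn (inIx (D t)) (M t v)).PosDef) (t : ι)
    (v' : GaugeField P (k+1) U1) (hvq : ∀ q : Cfg P k, vCut Qu (Λ t) ((D t).freeze q).1 v' = vCut Qu (Λ t) q.1 v')
    (e : (D t).Ext) : Integrable (fun i => sW Λ Qu D M t ((D t).glue e i) v') ((D t).μInt m) := by
  have hfun : (fun i => sW Λ Qu D M t ((D t).glue e i) v') = fun i : (D t).Int =>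
      (fun c : (D t).IX => wIn (inIx (D t)) (M t (vCut Qu (Λ t) ((D t).glue e (D t).base).1 v')) (chartIn (D t) c) *
        cpl (inIx (D t)) (M t (vCut Qu (Λ t) ((D t).glue e (D t).base).1 v')) (chartIn (D t) c) (chartOut (D t) e.2.2)) i.2.2 := by
    funext i; exact sW_glue t v' hvq e i
  rw [hfun]
  have hF := integrable_wIn_cpl (inIx (D t)) (hMs t (vCut Qu (Λ t) ((D t).glue e (D t).base).1 v'))
    (hMpd t _) (chartOut (D t) e.2.2)
  have hF' := ((measurePreserving_chartIn (D t)).integrable_comp_emb (chartIn (D t)).measurableEmbedding).mpr hF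
  unfold Interior.μInt
  exact (hF'.comp_snd _).comp_snd _

/-! ## §2 (5.9.6) ⇒ (5.12.8) with the scalar sector instantiated -/

/-- **ROW C2.Eq5.12.8, SCALAR SECTOR INSTANTIATED BY NAME.**  From the translated display (5.9.6) over `u ~ Π_b m_b` (`IsDT`; the family already
enlarged by the expansions of Sect. 5.11) whose bracket, read on configurations, is
`X₀_t · exp(−½⟨φ^{(k)}, M_t(v)φ^{(k)}⟩) · B₀_t` — `M_t(v)` the (real, symmetric) matrix of the `φ^{(k)}`-Gaussian (print: `Δ_{k,loc}(u_{k+1}) +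
aL^{−2}P(u_{k+1})`, p. 301) with positive definite `Λ₁₀`-block (*"The inverse covariance is … bounded from above and from below"*, p. 300) and
measurable entries, `X₀_t` NOT depending on the interior variables (lines 2–8 of (5.9.6) outside `Λ₁₀`), `B₀_t` ANYTHING (`χ′_{Λ₇} Π F^{m̄} e^{−V^{(k)}}`
and the gauge-field factors) — the density satisfies (5.12.8) (`IsDC`) with: exterior measures `Π_{j≤k}du^{(j)}|_{Λ^{(j)c*}_{10}}dφ^{(k)}|_{Λ^{(k)c}_{10}}`,
exterior bracket `X₀_t · exp(−½⟨Λ₁₀ᶜφ, MΛ₁₀ᶜφ⟩) · 𝒩_t` with `𝒩_t` = the total interior weight of p10's `wIn · cpl` (`normW`), interior laws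
`dμ^{(k)}_{Λ₁₀} = 𝒩⁻¹ · (wIn · cpl) · dφ^{(k)}|_{Λ₁₀} du|_{interior}` (`condW`) and interior bracket `B₀_t`.  The factorization hypothesis `hfac` of
`BIJ88Eq5128Frame.isDC_of_isDT` is DISCHARGED (`hfac_scalar`); the weight data `hWm`/`hW0`/`hWi` are PROVED (`measurable_sW`, `sW_pos`,
`integrable_sW_fibre`); remaining hypotheses: printed data (`M`, `X₀`, `B₀`, the locality `hv` of the block field — r18's `qU` satisfies it,
`BIJ88Eq5128Locality.vCut_freeze_eq_qU`) and integrability (`hJi`). [cite: BalabanImbrieJaffe1988, (5.12.8) p.303] -/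
theorem isDC_of_isDT_scalar {terms : Finset ι} {J : ι → Prev P k → GaugeField P k U1 → GaugeField P (k+1) U1 → HiggsField P k → HiggsField P (k+1) → ℂ}
    {ρL : GaugeField P (k+1) U1 → HiggsField P (k+1) → ℂ}
    (h : IsDT (Measure.pi m) terms Λ Qu J ρL) (hQu : Measurable Qu)
    (hMs : ∀ t v, (M t v).IsSymm) (hMpd : ∀ t v, (blkIn (inIx (D t)) (M t v)).PosDef) (hMm : ∀ t i j, Measurable fun v => M t v i j)
    (X₀ B₀ : ι → Cfg P k → GaugeField P (k+1) U1 → HiggsField P (k+1) → ℂ)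
    (hv : ∀ t ∈ terms, ∀ (q : Cfg P k) (v' : GaugeField P (k+1) U1), vCut Qu (Λ t) ((D t).freeze q).1 v' = vCut Qu (Λ t) q.1 v')
    (hX₀ : ∀ t ∈ terms, ∀ q v' ψ, X₀ t ((D t).freeze q) v' ψ = X₀ t q v' ψ)
    (hJ : ∀ t ∈ terms, ∀ q v' ψ, readEntry Λ Qu J t q v' ψ =
      X₀ t q v' ψ * (Real.exp (-(1 / 2 : ℝ) * (realCoords q.2.2 ⬝ᵥ (M t (vCut Qu (Λ t) q.1 v') *ᵥ realCoords q.2.2))) : ℂ) * B₀ t q v' ψ)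
    (hJi : ∀ t ∈ terms, Integrable (termIntegrand Λ Qu J t) (termMeasure (Measure.pi m))) :
    IsDC terms Λ Qu (fun t => (D t).extMeasure m)
      (fun t q v' ψ => X₀ t q v' ψ * (sX Λ Qu D M t q v' : ℂ) * (normW (D t) m (fun q' => sW Λ Qu D M t q' v') q : ℂ))
      (fun t q v' _ => condW (D t) m (fun q' => sW Λ Qu D M t q' v') q) B₀ ρL :=
  isDC_of_isDT h hQu D (fun t q v' ψ => X₀ t q v' ψ * (sX Λ Qu D M t q v' : ℂ)) B₀ (fun t q v' _ => sW Λ Qu D M t q v') hv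
    (hfac_scalar hMs hv hX₀ hJ) (fun t _ => measurable_sW hQu hMm t measurable_fst measurable_snd.fst)
    (fun t _ q v' _ => sW_pos t q v') (fun t ht e v' _ => integrable_sW_fibre hMs hMpd t v' (fun q => hv t ht q v') e) hJi

/-! ## §3 `𝒩` in closed form: p10's `calN` = `Z_{Λ₁₀}(u_{k+1}) · e^{thirdForm}` ((5.12.1)/(5.12.2) by name) -/

/-- **`𝒩_t` OF THE FRAME IS p10's `𝒩`**: the total interior weight `normW` of the scalar weight at a configuration `q` equals
`BIJ88Conditioning512.calN` (*"𝒩 is equal to the last integral, without G(φ)"*) at the precision `M_t(v)` and the exterior field `y = φ^{(k)}|_{Λ₁₀ᶜ}` of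
`q` — the interior gauge laws integrate to one, the interior scalar integral is taken in real coordinates (`measurePreserving_chartIn`).
[cite: BalabanImbrieJaffe1988, (5.12.2) p.301] -/
theorem normW_sW (t : ι) (v' : GaugeField P (k+1) U1)
    (hvq : ∀ q : Cfg P k, vCut Qu (Λ t) ((D t).freeze q).1 v' = vCut Qu (Λ t) q.1 v') (q : Cfg P k) :
    normW (D t) m (fun q' => sW Λ Qu D M t q' v') q = calN (inIx (D t)) (Mq Λ Qu M t q v') (yOf (D t) q) := by
  rw [normW, condNorm]
  set G : (In (inIx (D t)) → ℝ) → ℝ := fun x =>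
    wIn (inIx (D t)) (Mq Λ Qu M t q v') x * cpl (inIx (D t)) (Mq Λ Qu M t q v') x (yOf (D t) q) with hGdef
  have hfun : (fun i => sW Λ Qu D M t ((D t).glue ((D t).split q).1 i) v') = fun i : (D t).Int => G (chartIn (D t) i.2.2) := by
    funext i
    rw [sW_glue t v' hvq, ← Interior.freeze_eq_glue, hvq q, ← yOf_eq]
    rfl
  rw [hfun, integral_μInt_scalar (D t) (fun c => G (chartIn (D t) c)), integral_chartIn (D t) G]
  rfl

/-- **p10's `𝒩` in the names of (5.12.1)/(5.12.2)**: `𝒩(y) = Z_{Λ₁₀}(M) · exp(thirdForm)` with `Z_{Λ₁₀} = ∫dφ|_{Λ₁₀} e^{−½⟨φ, M_Λφ⟩}`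
(`BIJ88ExteriorForms5121.Zscalar`) and the third form `+½⟨Λᶜφ, M C_{Λ₁₀} M Λᶜφ⟩`, `C_{Λ₁₀} = M_Λ⁻¹` (`thirdForm`; `BIJ88Conditioning512.calN_eq`).
[cite: BalabanImbrieJaffe1988, (5.12.1) p.301] -/
theorem calN_eq_Zscalar_mul_exp_thirdForm {S : Type} [Fintype S] [DecidableEq S] (p : S → Prop) [DecidablePred p] (A : Matrix S S ℝ)
    (hA : A.IsSymm) (hpd : (blkIn p A).PosDef) (y : Out p → ℝ) :
    calN p A y = Zscalar p A * Real.exp (thirdForm p A A y) := by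
  rw [calN_eq p A hA hpd y]
  rfl

/-- With the print's two operators — `Δ = Δ_{k,loc}(u_{k+1})` and `M = Δ + aL^{−2}P(u_{k+1})`, `P` without `Λ₁₀ × Λ₁₀ᶜ` block
(`BIJ88ExteriorForms5121.blkMix_add_of_blockLocal`) — the third form carries `Δ` alone, as printed. [cite: BalabanImbrieJaffe1988, (5.12.1) p.301] -/
theorem thirdForm_blockLocal {S : Type} [Fintype S] [DecidableEq S] (p : S → Prop) [DecidablePred p] (Δ Pm : Matrix S S ℝ)
    (hP : blkMix p Pm = 0) (y : Out p → ℝ) : thirdForm p (Δ + Pm) (Δ + Pm) y = thirdForm p Δ (Δ + Pm) y := by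
  unfold thirdForm
  rw [BIJ88ExteriorForms5121.blkMix_add_of_blockLocal p Δ Pm hP]

/-- **(5.12.8), SCALAR SECTOR, WITH `𝒩` IN CLOSED FORM** — the exterior bracket is `X₀_t · exp(−½⟨Λ₁₀ᶜφ, MΛ₁₀ᶜφ⟩) · Z_{Λ₁₀}(M_t(v)) · exp(thirdForm)`:
the `φ^{(k)}`-Gaussian of the exterior integral *"has been replaced by"* the third form of (5.12.1) together with `Z^{(k)}_{Λ₁₀}(u_{k+1})` (p. 301:
*"The third form, together with Z_{Λ₁₀}(u_{k+1}), is a calculation of ∫dφ|_{Λ₁₀} exp[−½⟨Λ₁₀φ, (Δ+aL⁻²P)(Λ₁₀+2Λ₁₀ᶜ)φ⟩]"*, p02's `thirdForm_calc`),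
the interior laws are `dμ_{Λ₁₀} = 𝒩⁻¹(wIn·cpl)·(interior law)` ((5.12.2)/(5.12.7), scalar factor) and the interior bracket is `B₀_t`.
[cite: BalabanImbrieJaffe1988, (5.12.8) p.303] -/
theorem eq5128_scalar {terms : Finset ι} {J : ι → Prev P k → GaugeField P k U1 → GaugeField P (k+1) U1 → HiggsField P k → HiggsField P (k+1) → ℂ}
    {ρL : GaugeField P (k+1) U1 → HiggsField P (k+1) → ℂ}
    (h : IsDT (Measure.pi m) terms Λ Qu J ρL) (hQu : Measurable Qu)
    (hMs : ∀ t v, (M t v).IsSymm) (hMpd : ∀ t v, (blkIn (inIx (D t)) (M t v)).PosDef) (hMm : ∀ t i j, Measurable fun v => M t v i j)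
    (X₀ B₀ : ι → Cfg P k → GaugeField P (k+1) U1 → HiggsField P (k+1) → ℂ)
    (hv : ∀ t ∈ terms, ∀ (q : Cfg P k) (v' : GaugeField P (k+1) U1), vCut Qu (Λ t) ((D t).freeze q).1 v' = vCut Qu (Λ t) q.1 v')
    (hX₀ : ∀ t ∈ terms, ∀ q v' ψ, X₀ t ((D t).freeze q) v' ψ = X₀ t q v' ψ)
    (hJ : ∀ t ∈ terms, ∀ q v' ψ, readEntry Λ Qu J t q v' ψ =
      X₀ t q v' ψ * (Real.exp (-(1 / 2 : ℝ) * (realCoords q.2.2 ⬝ᵥ (M t (vCut Qu (Λ t) q.1 v') *ᵥ realCoords q.2.2))) : ℂ) * B₀ t q v' ψ)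
    (hJi : ∀ t ∈ terms, Integrable (termIntegrand Λ Qu J t) (termMeasure (Measure.pi m))) :
    IsDC terms Λ Qu (fun t => (D t).extMeasure m)
      (fun t q v' ψ => X₀ t q v' ψ * (sX Λ Qu D M t q v' : ℂ) *
        ((Zscalar (inIx (D t)) (Mq Λ Qu M t q v') * Real.exp (thirdForm (inIx (D t)) (Mq Λ Qu M t q v') (Mq Λ Qu M t q v') (yOf (D t) q)) : ℝ) : ℂ))
      (fun t q v' _ => condW (D t) m (fun q' => sW Λ Qu D M t q' v') q) B₀ ρL := by
  refine (isDC_of_isDT_scalar h hQu hMs hMpd hMm X₀ B₀ hv hX₀ hJ hJi).congr (fun t ht q v' ψ => ?_) (fun _ _ _ _ _ => rfl)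
  rw [normW_sW t v' (fun q => hv t ht q v') q, calN_eq_Zscalar_mul_exp_thirdForm _ (Mq Λ Qu M t q v') (hMs t _) (hMpd t _)]

/-! ## §4 The interior integral by name: `(1/𝒩)∫dφ|_{Λ₁₀} G e^{−½⟨φ,M_Λφ⟩}e^{−⟨Λᶜφ,MΛφ⟩}` and p. 302's Gaussian reading -/

/-- **THE INTERIOR INTEGRAL OF (5.12.2)/(5.12.8) BY NAME** — integrating any `G` against the interior law `dμ^{(k)}_{Λ₁₀}` of the frame
(`condW` of the scalar weight) over the fibre of the exterior configuration `e` is *"× (1/𝒩) ∫dφ|_Λ G(φ) e^{−½⟨φ, Δ_Λφ⟩} e^{−⟨Λᶜφ, ΔΛφ⟩}"* (p. 300):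
`𝒩⁻¹ · ∫ (wIn·cpl) · G` over the interior variables, `𝒩` = p10's `calN` at the precision `M_t(v)` and the exterior field of the fibre.
[cite: BalabanImbrieJaffe1988, (5.12.2) p.301] -/
theorem integral_condW_sW (hQu : Measurable Qu) (hMm : ∀ t i j, Measurable fun v => M t v i j) (hMs : ∀ t v, (M t v).IsSymm)
    (hMpd : ∀ t v, (blkIn (inIx (D t)) (M t v)).PosDef) (t : ι) (v' : GaugeField P (k+1) U1)
    (hvq : ∀ q : Cfg P k, vCut Qu (Λ t) ((D t).freeze q).1 v' = vCut Qu (Λ t) q.1 v') (e : (D t).Ext) (i : (D t).Int)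
    (G : Cfg P k → ℂ) :
    ∫ q', G q' ∂condW (D t) m (fun q' => sW Λ Qu D M t q' v') ((D t).glue e i) =
      ((calN (inIx (D t)) (Mq Λ Qu M t ((D t).glue e i) v') (yOf (D t) ((D t).glue e i)))⁻¹ : ℝ) *
        ∫ i', (sW Λ Qu D M t ((D t).glue e i') v' : ℂ) * G ((D t).glue e i') ∂(D t).μInt m := by
  have hw : Measurable fun i' : (D t).Int => sW Λ Qu D M t ((D t).glue e i') v' :=
    measurable_sW hQu hMm t ((D t).measurableEmbedding_glue e).measurable measurable_const
  rw [integral_condW_glue, integral_condMeasure_mul hw (fun i' => (sW_pos t _ v').le) (integrable_sW_fibre (m := m) hMs hMpd t v' hvq e),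
    ← normW_sW (m := m) t v' hvq ((D t).glue e i), normW_glue (D := D t) (m := m) (W := fun q' => sW Λ Qu D M t q' v') e i]

/-- **p. 302 BY NAME, for observables of the interior scalar field**: *"Here dμ^{(k)}_{Λ₁₀} is an uncentered, normalized Gaussian measure … This
measure has covariances … C^{(k)}_{Λ₁₀}(u_{k+1}), and nonzero means reflecting the terms linear in Λ₁₀φ^{(k)″}"* — under the interior law of the
frame, the interior real coordinates `x = φ^{(k)″}|_{Λ₁₀}` are distributed by the Gaussian probability measure of covariance `C_{Λ₁₀}(u_{k+1}) = M_Λ⁻¹`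
(`B2Eq228Conditioning.gaussProb (blkIn M)`) translated by the mean `−M_Λ⁻¹J(y)`, `J(y) = ΛMΛᶜφ` (p10's `normalized_eq_gaussProb`; p02's
`BIJ88Measure5127.muφ`/`meanφ` in these coordinates): for every real `G` of `x`, `∫ G(x(q′)) dμ_{Λ₁₀}(q′) = ∫ G(z − M_Λ⁻¹J(y)) dν_{M_Λ}(z)`.
[cite: BalabanImbrieJaffe1988, (5.12.7) p.302] -/
theorem integral_condW_sW_scalar_obs (hQu : Measurable Qu) (hMm : ∀ t i j, Measurable fun v => M t v i j) (hMs : ∀ t v, (M t v).IsSymm)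
    (hMpd : ∀ t v, (blkIn (inIx (D t)) (M t v)).PosDef) (t : ι) (v' : GaugeField P (k+1) U1)
    (hvq : ∀ q : Cfg P k, vCut Qu (Λ t) ((D t).freeze q).1 v' = vCut Qu (Λ t) q.1 v') (e : (D t).Ext) (i : (D t).Int)
    (G : (In (inIx (D t)) → ℝ) → ℝ) :
    ∫ q', G (xOf (D t) q') ∂condW (D t) m (fun q' => sW Λ Qu D M t q' v') ((D t).glue e i) =
      ∫ z, G (z - (blkIn (inIx (D t)) (Mq Λ Qu M t ((D t).glue e i) v'))⁻¹ *ᵥ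
        srcJ (inIx (D t)) (Mq Λ Qu M t ((D t).glue e i) v') (yOf (D t) ((D t).glue e i)))
        ∂B2Eq228Conditioning.gaussProb (blkIn (inIx (D t)) (Mq Λ Qu M t ((D t).glue e i) v')) := by
  set A := Mq Λ Qu M t ((D t).glue e i) v' with hAdef
  set y := yOf (D t) ((D t).glue e i) with hydef
  have hw : Measurable fun i' : (D t).Int => sW Λ Qu D M t ((D t).glue e i') v' :=
    measurable_sW hQu hMm t ((D t).measurableEmbedding_glue e).measurable measurable_const
  rw [integral_condW_glue, integral_condMeasure hw (fun i' => (sW_pos t _ v').le) (integrable_sW_fibre (m := m) hMs hMpd t v' hvq e),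
    ← normW_glue (D := D t) (m := m) (W := fun q' => sW Λ Qu D M t q' v') e i, normW_sW t v' hvq ((D t).glue e i), smul_eq_mul]
  -- the weighted interior integral is p10's `lastInt` of `G ∘ resIn`
  have hA' : M t (vCut Qu (Λ t) ((D t).glue e (D t).base).1 v') = A := by
    rw [hAdef, Mq, ← hvq ((D t).glue e i), Interior.freeze_glue]
  have hy' : chartOut (D t) e.2.2 = y := by rw [hydef, yOf_glue]
  set G' : (RIdx P k → ℝ) → ℝ := fun φ => G (resIn (inIx (D t)) φ) with hG'def
  have hfun : (fun i' : (D t).Int => sW Λ Qu D M t ((D t).glue e i') v' • G (xOf (D t) ((D t).glue e i'))) =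
      fun i' => (fun x => G' (glue (inIx (D t)) x y) * (wIn (inIx (D t)) A x * cpl (inIx (D t)) A x y)) (chartIn (D t) i'.2.2) := by
    funext i'
    rw [sW_glue t v' hvq, xOf_glue, hA', hy', smul_eq_mul, hG'def]
    simp only [B2Eq228Conditioning.resIn_glue]
    ring
  rw [hfun, integral_μInt_scalar (D t) (fun c => G' (glue (inIx (D t)) (chartIn (D t) c) y) *
    (wIn (inIx (D t)) A (chartIn (D t) c) * cpl (inIx (D t)) A (chartIn (D t) c) y)),
    integral_chartIn (D t) (fun x => G' (glue (inIx (D t)) x y) * (wIn (inIx (D t)) A x * cpl (inIx (D t)) A x y))]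
  have key := BIJ88Conditioning512.normalized_eq_gaussProb (inIx (D t)) A (hMs t _) (hMpd t _) G' y
  rw [lastInt] at key
  rw [key]
  simp only [hG'def, B2Eq228Conditioning.resIn_glue]

/-! ## §5 Instances: `𝒟u δ_{Ax}`, and the block average of record -/

/-- **Instance `ν = ∫𝒟u δ_{Ax}(u)(·)`** — the measure of (5.9.6)/(5.12.8): `𝒟u δ_{Ax} = Π_b axialLaw_b` (`BIJ88Eq5128Frame.isDT_axial_iff`).
[cite: BalabanImbrieJaffe1988, (5.12.8) p.303] -/
theorem eq5128_scalar_axial {terms : Finset ι}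
    {J : ι → Prev P k → GaugeField P k U1 → GaugeField P (k+1) U1 → HiggsField P k → HiggsField P (k+1) → ℂ}
    {ρL : GaugeField P (k+1) U1 → HiggsField P (k+1) → ℂ}
    (h : IsDT (BIJ88RenormTransf311.axialMeasure P k U1) terms Λ Qu J ρL) (hQu : Measurable Qu)
    (hMs : ∀ t v, (M t v).IsSymm) (hMpd : ∀ t v, (blkIn (inIx (D t)) (M t v)).PosDef) (hMm : ∀ t i j, Measurable fun v => M t v i j)
    (X₀ B₀ : ι → Cfg P k → GaugeField P (k+1) U1 → HiggsField P (k+1) → ℂ)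
    (hv : ∀ t ∈ terms, ∀ (q : Cfg P k) (v' : GaugeField P (k+1) U1), vCut Qu (Λ t) ((D t).freeze q).1 v' = vCut Qu (Λ t) q.1 v')
    (hX₀ : ∀ t ∈ terms, ∀ q v' ψ, X₀ t ((D t).freeze q) v' ψ = X₀ t q v' ψ)
    (hJ : ∀ t ∈ terms, ∀ q v' ψ, readEntry Λ Qu J t q v' ψ =
      X₀ t q v' ψ * (Real.exp (-(1 / 2 : ℝ) * (realCoords q.2.2 ⬝ᵥ (M t (vCut Qu (Λ t) q.1 v') *ᵥ realCoords q.2.2))) : ℂ) * B₀ t q v' ψ)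
    (hJi : ∀ t ∈ terms, Integrable (termIntegrand Λ Qu J t) (termMeasure (Measure.pi (axialLaw P k)))) :
    IsDC terms Λ Qu (fun t => (D t).extMeasure (axialLaw P k))
      (fun t q v' ψ => X₀ t q v' ψ * (sX Λ Qu D M t q v' : ℂ) *
        ((Zscalar (inIx (D t)) (Mq Λ Qu M t q v') * Real.exp (thirdForm (inIx (D t)) (Mq Λ Qu M t q v') (Mq Λ Qu M t q v') (yOf (D t) q)) : ℝ) : ℂ))
      (fun t q v' _ => condW (D t) (axialLaw P k) (fun q' => sW Λ Qu D M t q' v') q) B₀ ρL :=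
  eq5128_scalar (m := axialLaw P k) (isDT_axial_iff.mp h) hQu hMs hMpd hMm X₀ B₀ hv hX₀ hJ hJi

/-- **THE LOCALITY `hv` BY NAME for the block average of record** (r18's `BIJ85BlockAveragesTorus.qU`, (2.10)–(2.11) of [BalabanImbrieJaffe1985]):
under the nesting condition of p. 300 — no fine bond entering `(Qu)_c` for a block bond `c` off the cut-off `Λ_t` is interior
(`BIJ88Eq5128Locality.vCut_freeze_eq_qU`) — (5.12.8) for the scalar sector holds with hypotheses = printed data (`M`, `X₀`, `B₀`, the index
sets) + integrability. [cite: BalabanImbrieJaffe1988, (5.12.8) p.303] -/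
theorem eq5128_scalar_qU {terms : Finset ι} {Λ : ι → Finset (PBond P (k+1))} {D : ι → Interior P k}
    {M : ι → GaugeField P (k+1) U1 → Matrix (RIdx P k) (RIdx P k) ℝ}
    {J : ι → Prev P k → GaugeField P k U1 → GaugeField P (k+1) U1 → HiggsField P k → HiggsField P (k+1) → ℂ}
    {ρL : GaugeField P (k+1) U1 → HiggsField P (k+1) → ℂ}
    (h : IsDT (Measure.pi m) terms Λ BIJ85BlockAveragesTorus.qU J ρL)
    (hMs : ∀ t v, (M t v).IsSymm) (hMpd : ∀ t v, (blkIn (inIx (D t)) (M t v)).PosDef) (hMm : ∀ t i j, Measurable fun v => M t v i j)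
    (X₀ B₀ : ι → Cfg P k → GaugeField P (k+1) U1 → HiggsField P (k+1) → ℂ)
    (hIb : ∀ t ∈ terms, ∀ c, c ∉ Λ t → ∀ b ∈ BIJ88Eq5128Locality.qUSupport c, b ∉ (D t).Ib)
    (hX₀ : ∀ t ∈ terms, ∀ q v' ψ, X₀ t ((D t).freeze q) v' ψ = X₀ t q v' ψ)
    (hJ : ∀ t ∈ terms, ∀ q v' ψ, readEntry Λ BIJ85BlockAveragesTorus.qU J t q v' ψ =
      X₀ t q v' ψ * (Real.exp (-(1 / 2 : ℝ) * (realCoords q.2.2 ⬝ᵥ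
        (M t (vCut BIJ85BlockAveragesTorus.qU (Λ t) q.1 v') *ᵥ realCoords q.2.2))) : ℂ) * B₀ t q v' ψ)
    (hJi : ∀ t ∈ terms, Integrable (termIntegrand Λ BIJ85BlockAveragesTorus.qU J t) (termMeasure (Measure.pi m))) :
    IsDC terms Λ BIJ85BlockAveragesTorus.qU (fun t => (D t).extMeasure m)
      (fun t q v' ψ => X₀ t q v' ψ * (sX Λ BIJ85BlockAveragesTorus.qU D M t q v' : ℂ) *
        ((Zscalar (inIx (D t)) (Mq Λ BIJ85BlockAveragesTorus.qU M t q v') *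
          Real.exp (thirdForm (inIx (D t)) (Mq Λ BIJ85BlockAveragesTorus.qU M t q v') (Mq Λ BIJ85BlockAveragesTorus.qU M t q v')
            (yOf (D t) q)) : ℝ) : ℂ))
      (fun t q v' _ => condW (D t) m (fun q' => sW Λ BIJ85BlockAveragesTorus.qU D M t q' v') q) B₀ ρL :=
  eq5128_scalar h BIJ85BlockAveragesTorus.measurable_qU hMs hMpd hMm X₀ B₀
    (fun t ht q v' => BIJ88Eq5128Locality.vCut_freeze_eq_qU (D t) (Λ t) (hIb t ht) q v') hX₀ hJ hJi

end Scalar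

end

end Literature.MathematicalPhysics.QuantumFieldTheory.BalabanImbrieJaffe1984to88.BIJ88Eq5128ScalarSector
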